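import Summits.Ventures.Crystal3D.Theorems.StickyWulffConstantGenericWallFloorGrainCredits
import Summits.Ventures.Crystal3D.Theorems.StickyWulffConstantGenericWallFloorSiteLedger
import HarnessLib

/-!
# The grain lemma of the slot ledger: a clamped grain pays its two faces plus one

HONEST FRAMING. Part of the venture `Summits/Ventures/Crystal3D` (cell `crystal3d-full`), helper for the
crux `GenericWallFloor` (stmt-Ventures-19480) of `route-Ventures-StickyWulffConstant`, line `WallLedgerG`:
the per-grain half of the rigid-bicrystal rung of `stub_twoSlabAdhesion`.  Rung credit only.

**Theorem (`grain_ledger_ge`, bottom grain).**  Let `X` be `1`-separated in the cell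
`{−2R₀ ≤ x₂ ≤ h + 2R₀, x₀² + x₁² ≤ ρ²}` (`3 ≤ R₀ ≤ ρ`, `0 ≤ h`), let the grain `Λ = A·Λ₀ + t` have its
clamped slab `P = Λ ∩ {−2R₀ ≤ x₂ ≤ −R₀, x₀² + x₁² ≤ ρ²}` inside `X`, let the outer sliver be clean (balls
of `X` below height `−2R₀ + 1` are grain balls), and let `u` be a steep up-slot (`⟪A u, e₃⟫ ≥ √2/2`,
`exists_steep_slot`).  ASSUME the local non-saturation property: every grain ball `x ∈ X` with
`x + A u ∉ X`, `x − A u ∈ X` and a foreign contact has at most eleven contacts.  Then the grain's share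
of the ledger `2·D(X) = Σ_x (12 − deg x)` is at least its two faces plus one unit of area:

  `Σ_{x ∈ X ∩ Λ} (12 − deg_X x) ≥ (2 φ(A⁻¹e₃) + 1) π ρ² − C (1 + h) ρ`,
  `φ(A⁻¹e₃) = (√2/4) Σ_{w ∈ fccSlots} |⟪A w, e₃⟫|`, `C = 130 √2 π + 624 (4R₀ + 2)`.

Proof (slot ledger, `…GrainCredits`): credit the outer run ends inside `P` (`2φ π ρ²` of them) and the
structured `u`-tops of the grain (`≥ π ρ²`); at a non-rim ball with a foreign contact there is no outer
credit and an inner credit is top-structured, so non-saturation gives `12 − deg ≥ 1 =` its credit; at a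
ball without foreign contact `12 − deg = #empty slots ≥` its credits; rim balls are `O((1 + h) ρ)`.

WHAT THIS IS NOT: the non-saturation property is an HYPOTHESIS here (certified numerically on the item,
M5/M7-CERT; twin pairs violate it); the top grain and the two-grain assembly are the next file; rung F-C1
not moved.
-/

noncomputable section

namespace Summit.Ventures.Crystal3D.Theorems

open Summit.Ventures.Crystal3D Finset
open Literature.MathematicalPhysics.StatisticalMechanics (fccStacking)
open scoped InnerProductSpace

open scoped Classical in
/-- **The grain lemma (bottom grain).**  See the module docstring. -/
theorem grain_ledger_ge
    (A : EuclideanSpace ℝ (Fin 3) ≃ₗᵢ[ℝ] EuclideanSpace ℝ (Fin 3)) (t : EuclideanSpace ℝ (Fin 3))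
    (X P : Finset (EuclideanSpace ℝ (Fin 3))) (R₀ h ρ : ℝ) (hR₀ : 3 ≤ R₀) (hh : 0 ≤ h) (hρ : R₀ ≤ ρ)
    (hX : ∀ p ∈ X, ∀ q ∈ X, p ≠ q → 1 ≤ dist p q)
    (hcell : ∀ p ∈ X, -(2 * R₀) ≤ p 2 ∧ p 2 ≤ h + 2 * R₀ ∧ p 0 ^ 2 + p 1 ^ 2 ≤ ρ ^ 2)
    (hPX : P ⊆ X)
    (hP : ∀ p, p ∈ P ↔ (p ∈ (fun q => A q + t) '' fccStacking 1 (Real.sqrt (2 / 3)) ∧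
      -(2 * R₀) ≤ p 2 ∧ p 2 ≤ -R₀ ∧ p 0 ^ 2 + p 1 ^ 2 ≤ ρ ^ 2))
    (hclean : ∀ p ∈ X, p 2 < -(2 * R₀) + 1 → p ∈ (fun q => A q + t) '' fccStacking 1 (Real.sqrt (2 / 3)))
    {u : EuclideanSpace ℝ (Fin 3)} (hu : u ∈ fccSlots)
    (hsteep : Real.sqrt 2 / 2 ≤ ⟪A u, EuclideanSpace.single (2 : Fin 3) (1 : ℝ)⟫_ℝ)
    (hunsat : ∀ x ∈ X, x ∈ (fun q => A q + t) '' fccStacking 1 (Real.sqrt (2 / 3)) →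
      x + A u ∉ X → x - A u ∈ X →
      (∃ q ∈ X, q ∉ (fun q => A q + t) '' fccStacking 1 (Real.sqrt (2 / 3)) ∧ dist x q = 1) →
      (X.filter fun q => dist x q = 1).card ≤ 11) :
    (2 * (Real.sqrt 2 / 4 * ∑ w ∈ fccSlots, |⟪A w, EuclideanSpace.single (2 : Fin 3) (1 : ℝ)⟫_ℝ|) + 1) *
        Real.pi * ρ ^ 2 - (130 * Real.sqrt 2 * Real.pi + 624 * (4 * R₀ + 2)) * (1 + h) * ρ ≤
      ∑ x ∈ X.filter (fun x => x ∈ (fun q => A q + t) '' fccStacking 1 (Real.sqrt (2 / 3))),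
        ((12 : ℝ) - ((X.filter fun q => dist x q = 1).card : ℝ)) := by
  classical
  set e₃ : EuclideanSpace ℝ (Fin 3) := EuclideanSpace.single (2 : Fin 3) (1 : ℝ) with he₃
  set Λ : Set (EuclideanSpace ℝ (Fin 3)) := (fun q => A q + t) '' fccStacking 1 (Real.sqrt (2 / 3)) with hΛ
  set X₁ : Finset (EuclideanSpace ℝ (Fin 3)) := X.filter (fun x => x ∈ Λ) with hX₁
  set Down : Finset (EuclideanSpace ℝ (Fin 3)) := fccSlots.filter (fun w => ⟪A w, e₃⟫_ℝ < 0) with hDown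
  set O : EuclideanSpace ℝ (Fin 3) → Finset (EuclideanSpace ℝ (Fin 3)) :=
    fun w => P.filter (fun p => p + A w ∉ P) with hO
  set I : Finset (EuclideanSpace ℝ (Fin 3)) :=
    X₁.filter (fun q => q + A u ∉ X₁ ∧ (q ∈ P ∨ q - A u ∈ X₁)) with hI
  set deg : EuclideanSpace ℝ (Fin 3) → ℕ := fun x => (X.filter fun q => dist x q = 1).card with hdeg
  set k : EuclideanSpace ℝ (Fin 3) → ℕ :=
    fun x => (Down.filter fun w => x ∈ O w).card + (if x ∈ I then 1 else 0) with hk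
  have hρ0 : (0 : ℝ) ≤ ρ := by linarith
  have hρ2 : (0 : ℝ) ≤ ρ - 2 := by linarith
  have hPX₁ : P ⊆ X₁ := by
    intro p hp
    rw [hX₁, mem_filter]
    exact ⟨hPX hp, ((hP p).1 hp).1⟩
  have hX₁X : X₁ ⊆ X := filter_subset _ _
  have hαu : 0 < ⟪A u, e₃⟫_ℝ := by
    have : (0 : ℝ) < Real.sqrt 2 / 2 := by positivity
    linarith
  have huDown : u ∉ Down := by
    rw [hDown, mem_filter]; push Not; intro _; exact hαu.le
  -- (1) credit counts
  have hOut := outerCredits_ge A t P R₀ ρ hR₀ hρ hP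
  have hIn := innerCredits_ge A t X₁ P R₀ ρ hR₀ hρ hPX₁ hP hu
  have hIn' : Real.pi * ρ ^ 2 - 10 * Real.sqrt 2 * Real.pi * ρ ≤ ((I.card : ℕ) : ℝ) := by
    have hs2 : Real.sqrt 2 * (Real.sqrt 2 / 2) = 1 := by
      rw [← mul_div_assoc, Real.mul_self_sqrt (by norm_num)]; norm_num
    have h1 : 1 ≤ Real.sqrt 2 * ⟪A u, e₃⟫_ℝ := by
      have := mul_le_mul_of_nonneg_left hsteep (Real.sqrt_nonneg 2)
      rwa [hs2] at this
    have h2 : Real.pi * ρ ^ 2 ≤ Real.sqrt 2 * ⟪A u, e₃⟫_ℝ * Real.pi * ρ ^ 2 := by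
      have : (0 : ℝ) ≤ Real.pi * ρ ^ 2 := by positivity
      nlinarith
    exact le_trans (by linarith) hIn
  -- (2) the sum of the credits per ball
  have hk_sum : ∑ x ∈ X₁, (k x : ℝ) = ∑ w ∈ Down, ((O w).card : ℝ) + (I.card : ℝ) := by
    have hN1 : ∑ x ∈ X₁, (Down.filter fun w => x ∈ O w).card = ∑ w ∈ Down, (O w).card := by
      rw [Finset.sum_congr rfl (fun x _ => Finset.card_filter (fun w => x ∈ O w) Down), Finset.sum_comm]
      refine sum_congr rfl fun w _ => ?_
      rw [← Finset.card_filter, filter_mem_eq_inter, inter_eq_right.2 ((filter_subset _ _).trans hPX₁)]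
    have hN2 : ∑ x ∈ X₁, (if x ∈ I then 1 else 0) = I.card := by
      rw [← Finset.card_filter, filter_mem_eq_inter, inter_eq_right.2 (filter_subset _ _)]
    have hN : ∑ x ∈ X₁, k x = ∑ w ∈ Down, (O w).card + I.card := by
      simp only [hk, sum_add_distrib, hN1, hN2]
    have := congrArg (Nat.cast : ℕ → ℝ) hN
    push_cast at this
    exact this
  -- (3) per-ball facts
  have hdeg12 : ∀ x, deg x ≤ 12 := fun x => card_filter_dist_eq_one_le_twelve X hX x
  have hk13 : ∀ x, k x ≤ 13 := by
    intro x
    have h1 : (Down.filter fun w => x ∈ O w).card ≤ 12 :=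
      (card_filter_le _ _).trans ((card_filter_le _ _).trans (by rw [card_fccSlots]))
    have h2 : (if x ∈ I then 1 else 0) ≤ 1 := by split_ifs <;> norm_num
    simp only [hk]; omega
  -- outer credit ⇒ the slot is empty in X
  have hOempty : ∀ x w, w ∈ Down → x ∈ O w → x + A w ∉ X := by
    intro x w hw hx
    rw [hDown, mem_filter] at hw
    rw [hO, mem_filter] at hx
    exact outerSlot_not_mem A t X P R₀ h ρ hcell hP (mem_fcc_of_mem_fccSlots hw.1) hw.2.le hx.1 hx.2
  -- inner credit ⇒ the slot `u` is empty in X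
  have hIempty : ∀ x, x ∈ I → x + A u ∉ X := by
    intro x hx hmem
    rw [hI, mem_filter] at hx
    apply hx.2.1
    rw [hX₁, mem_filter]
    have hxΛ : x ∈ Λ := (mem_filter.1 hx.1).2
    exact ⟨hmem, movedFcc_add_site_mem A t hxΛ (mem_fcc_of_mem_fccSlots hu)⟩
  have hk_le : ∀ x ∈ X₁, ¬ ((ρ - 2) ^ 2 < x 0 ^ 2 + x 1 ^ 2) → (k x : ℝ) ≤ 12 - (deg x : ℝ) := by
    intro x hx hrim
    push Not at hrim
    have hxX : x ∈ X := hX₁X hx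
    have hxΛ : x ∈ Λ := (mem_filter.1 hx).2
    by_cases hfor : ∃ q ∈ X, q ∉ Λ ∧ dist x q = 1
    · -- a foreign contact: no outer credit, an inner credit is top-structured
      obtain ⟨q, hqX, hqΛ, hxq⟩ := hfor
      have hO0 : (Down.filter fun w => x ∈ O w) = ∅ := by
        rw [Finset.eq_empty_iff_forall_notMem]
        intro w hw
        rw [mem_filter] at hw
        obtain ⟨hwD, hxO⟩ := hw
        rw [hDown, mem_filter] at hwD
        rw [hO, mem_filter] at hxO
        exact hxO.2 (not_outerCredit_of_foreign A t X P R₀ ρ hR₀ hρ hX hPX hP hclean hxO.1 hrim hqX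
          hqΛ hxq hwD.1 hwD.2.le)
      by_cases hxI : x ∈ I
      · have hstr : x - A u ∈ X := by
          have hx' := hxI
          rw [hI, mem_filter] at hx'
          rcases hx'.2.2 with hxP | hsub
          · exact hPX (sub_mem_sample_of_foreign A t X P R₀ ρ hR₀ hρ hX hPX hP hclean hxP hrim hqX hqΛ
              hxq hu hsteep)
          · exact hX₁X hsub
        have h11 := hunsat x hxX hxΛ (hIempty x hxI) hstr ⟨q, hqX, hqΛ, hxq⟩
        have hkx : k x = 1 := by simp only [hk, hO0, card_empty, if_pos hxI]
        rw [hkx]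
        have : (deg x : ℝ) ≤ 11 := by exact_mod_cast h11
        push_cast; linarith
      · have hkx : k x = 0 := by simp only [hk, hO0, card_empty, if_neg hxI]
        rw [hkx]
        have : (deg x : ℝ) ≤ 12 := by exact_mod_cast hdeg12 x
        push_cast; linarith
    · -- no foreign contact: `12 − deg = #empty slots ≥ credits`
      push Not at hfor
      have hc0 : (X.filter fun q => dist x q = 1 ∧ q ∉ Λ).card = 0 := by
        rw [Finset.card_eq_zero, Finset.eq_empty_iff_forall_notMem]
        intro q hq
        rw [mem_filter] at hq
        exact hfor q hq.1 hq.2.2 hq.2.1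
      have hled := twelve_sub_degree_eq A t x X hxΛ
      rw [hc0] at hled
      -- credited slots ⊆ empty slots
      set C : Finset (EuclideanSpace ℝ (Fin 3)) :=
        (Down.filter fun w => x ∈ O w) ∪ (if x ∈ I then {u} else ∅) with hC
      have hCsub : C ⊆ fccSlots.filter fun w => x + A w ∉ X := by
        intro w hw
        rw [hC, mem_union] at hw
        rw [mem_filter]
        rcases hw with hw | hw
        · rw [mem_filter] at hw
          exact ⟨(mem_filter.1 hw.1).1, hOempty x w hw.1 hw.2⟩
        · split_ifs at hw with hxI
          · rw [mem_singleton] at hw; rw [hw]; exact ⟨hu, hIempty x hxI⟩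
          · simp at hw
      have hCcard : C.card = k x := by
        rw [hC, card_union_of_disjoint]
        · simp only [hk]
          split_ifs <;> simp
        · split_ifs with hxI
          · rw [disjoint_singleton_right, mem_filter]
            exact fun hmem => huDown hmem.1
          · exact disjoint_empty_right _
      have hkle : k x ≤ (fccSlots.filter fun w => x + A w ∉ X).card := by
        rw [← hCcard]; exact card_le_card hCsub
      have h1 : ((k x : ℕ) : ℤ) ≤ 12 - ((deg x : ℕ) : ℤ) := by
        have := hled
        simp only [hdeg]
        omega
      have h2 : ((k x : ℕ) : ℝ) ≤ ((12 - ((deg x : ℕ) : ℤ) : ℤ) : ℝ) := by exact_mod_cast h1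
      push_cast at h2
      exact h2
  -- (4) the rim count
  have hrim := card_cellRim_le X hX (-(2 * R₀)) (h + 2 * R₀) ρ (by linarith) (by linarith) hcell
  have hrim' : ((((X.filter fun p => (ρ - 2) ^ 2 < p 0 ^ 2 + p 1 ^ 2).card : ℕ) : ℝ)) ≤
      48 * (4 * R₀ + 2) * (1 + h) * ρ := by
    have e : h + 2 * R₀ - -(2 * R₀) + 2 = h + 4 * R₀ + 2 := by ring
    rw [e] at hrim
    have h1 : h + 4 * R₀ + 2 ≤ (4 * R₀ + 2) * (1 + h) := by nlinarith
    have h2 : ρ - 1 ≤ ρ := by linarith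
    have h3 : (0 : ℝ) ≤ h + 4 * R₀ + 2 := by linarith
    calc _ ≤ 48 * (h + 4 * R₀ + 2) * (ρ - 1) := hrim
      _ ≤ 48 * ((4 * R₀ + 2) * (1 + h)) * ρ := by
          have : (0 : ℝ) ≤ ρ - 1 := by linarith
          nlinarith
      _ = 48 * (4 * R₀ + 2) * (1 + h) * ρ := by ring
  -- (5) pointwise: `12 − deg x ≥ k x − 13·[rim x]` on `X₁`
  have hpt : ∀ x ∈ X₁, (k x : ℝ) - 13 * (if (ρ - 2) ^ 2 < x 0 ^ 2 + x 1 ^ 2 then 1 else 0) ≤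
      12 - (deg x : ℝ) := by
    intro x hx
    split_ifs with hr
    · have h1 : (k x : ℝ) ≤ 13 := by exact_mod_cast hk13 x
      have h2 : (deg x : ℝ) ≤ 12 := by exact_mod_cast hdeg12 x
      linarith
    · have := hk_le x hx hr; simpa using this
  have hsum := Finset.sum_le_sum hpt
  rw [sum_sub_distrib, ← mul_sum, sum_boole] at hsum
  -- the rim balls of X₁ are rim balls of X
  have hrimX₁ : (((X₁.filter fun x => (ρ - 2) ^ 2 < x 0 ^ 2 + x 1 ^ 2).card : ℕ) : ℝ) ≤
      (((X.filter fun p => (ρ - 2) ^ 2 < p 0 ^ 2 + p 1 ^ 2).card : ℕ) : ℝ) := by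
    exact_mod_cast card_le_card (filter_subset_filter _ hX₁X)
  rw [hk_sum] at hsum
  -- assemble
  have hDeg : ∑ x ∈ X₁, ((12 : ℝ) - ((X.filter fun q => dist x q = 1).card : ℝ)) =
      ∑ x ∈ X₁, ((12 : ℝ) - (deg x : ℝ)) := rfl
  rw [hDeg]
  have hpos : 0 ≤ Real.sqrt 2 * Real.pi * h * ρ := by positivity
  linarith [hOut, hIn', hsum, hrimX₁, hrim']

end Summit.Ventures.Crystal3D.Theorems

end
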